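import Summits.AtomisticToContinuum.Crystallization.Theorems.OverbindingBudgetRegularityCutStatements

/-!
# OverbindingBudget — the REGULARITY CUT, file 2: ε-regularity from the Liouville statement by compactness
(helper, `--supports stmt-AtomisticToContinuum-31280`; decomp-a2c lens 4 «minimal counterexample / extremal reduction», generation 24; node
«RegularityCut», file 2 of 2)

File 1 (`…RegularityCutStatements`) reduced the pricing piece of record to its energy-extremal class (`MuCleanBalls D`: `μ`-ground states have
`t`-clean balls of every radius), cut it exactly at a threshold margin `T₀` into the PRICING residual `GrossCleanBalls T₀ D` and the REGULARITY
piece `SoftCleanBalls T₀ D`, and reduced the latter to ε-regularity `CleanRegularity T₀ D`.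

This file proves the BLOW-DOWN step of the lens: **`cleanRegularity_of_cleanLiouville : MuGSCLimitClosed → CleanLiouville T₀ D →
CleanRegularity T₀ D`** (`0 ≤ T₀`).  Were ε-regularity false at data `(e, δ, a, t, L)`, there would be `δ`-separated `9/10`-covering
`μ`-ground states `Yₙ` with thin cores and sites `qₙ` whose `n`-balls are `T₀`-clean yet carry `t`-robust violators `L`-densely.  Re-root at
`qₙ` (§E: separation, covering, thin cores, the relaxed test and — ported here for general chemical potential over `Literature…MuGSC` —
the `μ`-ground-state property are translation covariant), extract a two-way locally matched subsequence and limit `Z`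
(`exists_subseq_forall_eventually_match`, generation 21), and pass everything to the limit (§F): covering (`solid_of_limit`), loosened thin
cores (`thinCoresL_of_limit`), `T₀`-cleanness at every site at every margin above `T₀` (`rtAbove_of_limit`: the relaxed test crosses a matching
with margin loss `3ε → 0`, `rt_of_match`), `t`-robust violators `L`-densely (`violatorsL_of_limit_local`: the local form of generation 22's
`violatorsL_of_limit` — cleanness on growing balls suffices), and the `μ`-ground-state property (the HYPOTHESIS `MuGSCLimitClosed`).  The limit
is a globally `T₀`-clean `μ`-ground state with a `t/2`-robust violator: the Liouville statement forbids it.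

Corollaries (§G): `muCleanBalls_of_gross_liouville : GrossCleanBalls T₀ D → CleanLiouville T₀ D → MuGSCLimitClosed → MuCleanBalls D`
(`0 < T₀ ≤ 1/10`) and the cone `rdef_of_gross_liouville_coherent : GrossCleanBalls T₀ 10 → CleanLiouville T₀ 10 → MuGSCLimitClosed →
CleanlessExcessT → CoherentResidual 10 → RobustDefectLimitWindows`.  All proofs complete (0 sorry), over landed Theorems files only.
-/

namespace Summit.AtomisticToContinuum.Crystallization.Theorems.OverbindingBudgetRegularityCutLimit

open Filter Metric Set Topology
open scoped BigOperators
open Literature.MathematicalPhysics.StatisticalMechanics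
open Summit.AtomisticToContinuum.Crystallization.Theses.OverbindingBudget (RobustDefectLimitWindows)
open Summit.AtomisticToContinuum.Crystallization.Theorems.OverbindingBudgetViolatorDensityFloor (GT RT)
open Summit.AtomisticToContinuum.Crystallization.Theorems.OverbindingBudgetWallTensionLever (CleanT ThinCores)
open Summit.AtomisticToContinuum.Crystallization.Theorems.OverbindingBudgetGradedBareness (CleanlessExcessT)
open Summit.AtomisticToContinuum.Crystallization.Theorems.OverbindingBudgetCoherentCut (CoherentResidual)
open Summit.AtomisticToContinuum.Crystallization.Theorems.OverbindingBudgetMatchCompactness (exists_subseq_forall_eventually_match)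
open Summit.AtomisticToContinuum.Crystallization.Theorems.OverbindingBudgetRecurrentSealStatements (sep_translate solid_translate
  translate_translate)
open Summit.AtomisticToContinuum.Crystallization.Theorems.OverbindingBudgetRecurrentSealClosure (solid_of_limit)
open Summit.AtomisticToContinuum.Crystallization.Theorems.OverbindingBudgetRecurrentDustStatements (ThinCoresL ViolatorsL rt_mono
  thinCoresL_of_thinCores thinCoresL_translate rt_translate)
open Summit.AtomisticToContinuum.Crystallization.Theorems.OverbindingBudgetRecurrentDustClosure (norm_le_of_dist_le rt_of_match
  thinCoresL_of_limit)
open Summit.AtomisticToContinuum.Crystallization.Theorems.OverbindingBudgetRegularityCutStatements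

/-! ## §E  Translation covariance of the `μ`-ground-state property (general chemical potential) -/

/-- The sites of `Z` off a translated finite part, and the sites of `Z − z` off the finite part (port of the sibling world's
`…RepetitiveNetworkReductionRecurrentMemberDefs.restEquiv`). [folklore] -/
def restEquiv (Z : Set (EuclideanSpace ℝ (Fin 3))) (z : EuclideanSpace ℝ (Fin 3)) {n : ℕ}
    (xf : Fin n → EuclideanSpace ℝ (Fin 3)) :
    ↥(Z \ Set.range (fun i => xf i + z)) ≃ ↥(((fun p => p - z) '' Z) \ Set.range xf) where
  toFun q := ⟨(q : EuclideanSpace ℝ (Fin 3)) - z, ⟨(q : EuclideanSpace ℝ (Fin 3)), q.2.1, rfl⟩, by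
      rintro ⟨i, hi⟩
      refine q.2.2 ⟨i, ?_⟩
      show xf i + z = (q : EuclideanSpace ℝ (Fin 3))
      rw [hi, sub_add_cancel]⟩
  invFun q := ⟨(q : EuclideanSpace ℝ (Fin 3)) + z, (by
      obtain ⟨p', hp', hp'w⟩ := q.2.1
      have e' : p' - z = _ := hp'w
      rw [← e', sub_add_cancel]; exact hp'), by
      rintro ⟨i, hi⟩
      exact q.2.2 ⟨i, add_left_injective z hi⟩⟩
  left_inv q := by
    ext1
    simp
  right_inv q := by
    ext1
    simp

/-- **Re-rooting preserves `μ`-ground states** (any chemical potential `μ`): summability from uniform discreteness, the finite-modification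
test translated back by `z` (port of the sibling world's `isMuGSC_image_sub`, there at `μ = e⋆` only). [folklore] -/
theorem isMuGSC_translate {Z : Set (EuclideanSpace ℝ (Fin 3))} {μ : ℝ} (hZ : UniformlyDiscrete Z) (h : IsMuGSC lennardJones μ Z)
    (z : EuclideanSpace ℝ (Fin 3)) : IsMuGSC lennardJones μ ((fun p => p - z) '' Z) := by
  have hUD' : UniformlyDiscrete ((fun p => p - z) '' Z) := by
    obtain ⟨δ, hδ, hsep⟩ := hZ
    exact ⟨δ, hδ, sep_translate z hsep⟩
  refine (isMuGSC_iff _ _ _).2 ⟨fun r => hUD'.summable_lennardJones r, ?_⟩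
  intro n xf hxf hxfW k R hR hdisj
  have hxf' : Function.Injective (fun i => xf i + z) := fun i j hij => hxf (add_left_injective z hij)
  have hR' : Function.Injective (fun i => R i + z) := fun i j hij => hR (add_left_injective z hij)
  have hxfZ : Set.range (fun i => xf i + z) ⊆ Z := by
    rintro _ ⟨i, rfl⟩
    obtain ⟨p', hp', hp'w⟩ := hxfW ⟨i, rfl⟩
    have e' : p' - z = xf i := hp'w
    show xf i + z ∈ Z
    rw [← e', sub_add_cancel]; exact hp'
  have hdisj' : Disjoint (Set.range (fun i => R i + z)) (Z \ Set.range (fun i => xf i + z)) := by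
    rw [Set.disjoint_left]
    rintro _ ⟨j, rfl⟩ hmem
    refine (Set.disjoint_left.1 hdisj) (Set.mem_range_self j) ⟨⟨R j + z, hmem.1, add_sub_cancel_right _ _⟩, ?_⟩
    rintro ⟨i, hi⟩
    refine hmem.2 ⟨i, ?_⟩
    show xf i + z = R j + z
    rw [hi]
  have key := ((isMuGSC_iff _ _ _).1 h).2 n (fun i => xf i + z) hxf' hxfZ k (fun i => R i + z) hR' hdisj'
  rw [interactionEnergy_add_const, interactionEnergy_add_const] at key
  have hfield : ∀ w : EuclideanSpace ℝ (Fin 3),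
      ∑' y : ↥(Z \ Set.range (fun i => xf i + z)), lennardJones (dist (w + z) (y : EuclideanSpace ℝ (Fin 3))) =
        ∑' y : ↥(((fun p => p - z) '' Z) \ Set.range xf), lennardJones (dist w (y : EuclideanSpace ℝ (Fin 3))) := by
    intro w
    rw [← Equiv.tsum_eq (restEquiv Z z xf)]
    refine tsum_congr fun y => ?_
    show lennardJones (dist (w + z) (y : EuclideanSpace ℝ (Fin 3))) = lennardJones (dist w ((y : EuclideanSpace ℝ (Fin 3)) - z))
    rw [← dist_sub_right (w + z) (y : EuclideanSpace ℝ (Fin 3)) z, add_sub_cancel_right]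
  simp only [hfield] at key
  exact key

/-! ## §F  Local limit closure: cleanness on growing balls, violators on growing balls -/

/-- **The relaxed test at every site of growing balls passes to local limits at every margin above**: if every site of `Zs k` within `ρ k`
of `0` passes `RT a T₀`, `ρ k → ∞`, then every site of a two-way local limit `Z` passes `RT a s` for every `s > T₀` (cross the matching
from the partner with margin loss `3ε ≤ s − T₀`, `rt_of_match`). [folklore] -/
theorem rtAbove_of_limit {δ a T₀ : ℝ} (hδ : 0 < δ) (ha : 47 / 50 ≤ a) (ha1 : a ≤ 1) (hT₀ : 0 ≤ T₀)
    {Zs : ℕ → Set (EuclideanSpace ℝ (Fin 3))} {Z : Set (EuclideanSpace ℝ (Fin 3))} (hsepk : ∀ k, ∀ p ∈ Zs k, ∀ q ∈ Zs k, p ≠ q → δ ≤ dist p q)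
    (hsep : ∀ p ∈ Z, ∀ q ∈ Z, p ≠ q → δ ≤ dist p q)
    (hconv : ∀ R ε : ℝ, 0 < ε → ∀ᶠ k in atTop, Match ε R 0 (Zs k) Z)
    {ρ : ℕ → ℝ} (hρ : Tendsto ρ atTop atTop)
    (hclean : ∀ k, ∀ y ∈ Zs k, ‖y‖ ≤ ρ k → RT a T₀ (Zs k) y) :
    ∀ y' ∈ Z, ∀ s : ℝ, T₀ < s → RT a s Z y' := by
  intro y' hy' s hs
  have ha0 : 0 < a := by linarith
  obtain ⟨ε, hε0, hε3, hεδ, hε2⟩ : ∃ ε : ℝ, 0 < ε ∧ 3 * ε ≤ s - T₀ ∧ 2 * ε < δ ∧ ε ≤ 1 / 2 :=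
    ⟨min ((s - T₀) / 3) (min (δ / 4) (1 / 2)), by positivity,
      by have := min_le_left ((s - T₀) / 3) (min (δ / 4) (1 / 2)); linarith,
      by have := (min_le_right ((s - T₀) / 3) (min (δ / 4) (1 / 2))).trans (min_le_left _ _); linarith,
      by have := (min_le_right ((s - T₀) / 3) (min (δ / 4) (1 / 2))).trans (min_le_right _ _); linarith⟩
  set R₀ : ℝ := ‖y'‖ + |T₀| + 6 with hR₀
  obtain ⟨k, hk, hkρ⟩ := ((hconv R₀ ε hε0).and (hρ.eventually_ge_atTop (‖y'‖ + 1))).exists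
  obtain ⟨y, hy, hyd⟩ := hk.1 y' hy' (by rw [dist_zero_right]; linarith [abs_nonneg T₀])
  have hyn : ‖y‖ ≤ ‖y'‖ + ε := norm_le_of_dist_le hyd
  have hRT : RT a T₀ (Zs k) y := hclean k y hy (by linarith)
  have hR1 : ‖y‖ + T₀ + 4 ≤ R₀ := by linarith [le_abs_self T₀]
  have h' := rt_of_match (hsepk k) hsep hε0.le hεδ hε2 hk ha0 ha1 hT₀ hy hy' hyd hR1 hRT
  exact rt_mono ⟨δ, hδ, hsep⟩ (by linarith) h'

/-- **Robust violators on growing balls pass to local limits, `L`-densely** — the local form of generation 22's `violatorsL_of_limit`: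
it suffices that within `ρ k → ∞` of `0` every site of `Zs k` has, within `L`, a site failing the relaxed test at every margin below `t`.
(Pigeonhole the limit partner of the approximants' violator along `ε → 0⁺`; a pass at margin `s < t` in the limit would cross back at
margin `s + 3ε < t`.) [folklore] -/
theorem violatorsL_of_limit_local {δ a t L : ℝ} (hδ : 0 < δ) (ha : 47 / 50 ≤ a) (ha1 : a ≤ 1)
    {Zs : ℕ → Set (EuclideanSpace ℝ (Fin 3))} {Z : Set (EuclideanSpace ℝ (Fin 3))} (hsepk : ∀ k, ∀ p ∈ Zs k, ∀ q ∈ Zs k, p ≠ q → δ ≤ dist p q)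
    (hsep : ∀ p ∈ Z, ∀ q ∈ Z, p ≠ q → δ ≤ dist p q)
    (hconv : ∀ R ε : ℝ, 0 < ε → ∀ᶠ k in atTop, Match ε R 0 (Zs k) Z)
    {ρ : ℕ → ℝ} (hρ : Tendsto ρ atTop atTop)
    (hV : ∀ k, ∀ q ∈ Zs k, ‖q‖ ≤ ρ k → ∃ y ∈ Zs k, dist y q ≤ L ∧ ∀ s : ℝ, 0 < s → s < t → ¬ RT a s (Zs k) y) :
    ViolatorsL a t L Z := by
  classical
  have ha0 : 0 < a := by linarith
  intro p hp
  set R₀ : ℝ := ‖p‖ + |L| + |t| + 10 with hR₀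
  have hk : ∀ ε : ℝ, ∃ k : ℕ, 0 < ε → Match ε R₀ 0 (Zs k) Z ∧ ‖p‖ + ε ≤ ρ k := by
    intro ε
    by_cases hε : 0 < ε
    · obtain ⟨k, hk⟩ := ((hconv R₀ ε hε).and (hρ.eventually_ge_atTop (‖p‖ + ε))).exists
      exact ⟨k, fun _ => hk⟩
    · exact ⟨0, fun h => absurd h hε⟩
  choose k hk using hk
  have hp0 : dist p 0 ≤ R₀ := by
    rw [dist_zero_right]; linarith [abs_nonneg L, abs_nonneg t, norm_nonneg p]
  -- partners of `p`, the violators near them, and their partners back in `Z`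
  have hpn : ∀ ε : ℝ, ∃ q : (EuclideanSpace ℝ (Fin 3)), 0 < ε → q ∈ Zs (k ε) ∧ dist q p ≤ ε := by
    intro ε
    by_cases hε : 0 < ε
    · obtain ⟨q, hq, hqd⟩ := (hk ε hε).1.1 p hp hp0
      exact ⟨q, fun _ => ⟨hq, hqd⟩⟩
    · exact ⟨0, fun h => absurd h hε⟩
  choose pn hpn using hpn
  have hyk : ∀ ε : ℝ, ∃ y : (EuclideanSpace ℝ (Fin 3)), 0 < ε → y ∈ Zs (k ε) ∧ dist y (pn ε) ≤ L ∧
      ∀ s : ℝ, 0 < s → s < t → ¬ RT a s (Zs (k ε)) y := by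
    intro ε
    by_cases hε : 0 < ε
    · obtain ⟨y, hy, hd, hn⟩ := hV (k ε) (pn ε) (hpn ε hε).1
        (by have := norm_le_of_dist_le (hpn ε hε).2; linarith [(hk ε hε).2])
      exact ⟨y, fun _ => ⟨hy, hd, hn⟩⟩
    · exact ⟨0, fun h => absurd h hε⟩
  choose yk hyk using hyk
  have hyn : ∀ ε, 0 < ε → ε ≤ 1 → ‖yk ε‖ ≤ ‖p‖ + |L| + 1 := by
    intro ε hε hε1
    have h1 := norm_le_of_dist_le (hyk ε hε).2.1
    have h2 := norm_le_of_dist_le (hpn ε hε).2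
    linarith [le_abs_self L]
  have hzz : ∀ ε : ℝ, ∃ q : (EuclideanSpace ℝ (Fin 3)), 0 < ε → ε ≤ 1 → q ∈ Z ∧ dist (yk ε) q ≤ ε := by
    intro ε
    by_cases hε : 0 < ε
    · by_cases hε1 : ε ≤ 1
      · obtain ⟨q, hq, hqd⟩ := (hk ε hε).1.2 _ (hyk ε hε).1
          (by rw [dist_zero_right]; linarith [hyn ε hε hε1, abs_nonneg L, abs_nonneg t])
        exact ⟨q, fun _ _ => ⟨hq, hqd⟩⟩
      · exact ⟨0, fun _ h => absurd h hε1⟩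
    · exact ⟨0, fun h => absurd h hε⟩
  choose zz hzz using hzz
  -- pigeonhole along `ε → 0⁺`
  set S : Set (EuclideanSpace ℝ (Fin 3)) := Z ∩ closedBall p (|L| + 2) with hS
  have hSfin : S.Finite := UniformlyDiscrete.finite_inter_closedBall (X := Z) ⟨δ, hδ, hsep⟩ p (|L| + 2)
  have hzzS : ∀ ε, 0 < ε → ε ≤ 1 → zz ε ∈ S := by
    intro ε hε hε1
    obtain ⟨hq, hqd⟩ := hzz ε hε hε1
    refine ⟨hq, mem_closedBall.2 ?_⟩
    have h1 := dist_triangle (zz ε) (yk ε) p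
    have h2 := dist_triangle (yk ε) (pn ε) p
    have h3 := dist_comm (zz ε) (yk ε)
    linarith [(hyk ε hε).2.1, (hpn ε hε).2, le_abs_self L]
  obtain ⟨q, hqS, hfreq⟩ : ∃ q ∈ S, ∃ᶠ ε in 𝓝[>] (0 : ℝ), zz ε = q := by
    by_contra hno
    push Not at hno
    have h1 : ∀ᶠ ε in 𝓝[>] (0 : ℝ), ∀ q ∈ S, zz ε ≠ q := hSfin.eventually_all.2 fun q hq => hno q hq
    have h2 : ∀ᶠ ε in 𝓝[>] (0 : ℝ), ε < 1 := (eventually_lt_nhds one_pos).filter_mono nhdsWithin_le_nhds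
    have h3 : ∀ᶠ ε in 𝓝[>] (0 : ℝ), 0 < ε := eventually_mem_nhdsWithin
    obtain ⟨ε, hε1, hε2, hε3⟩ := (h1.and (h2.and h3)).exists
    exact hε1 (zz ε) (hzzS ε hε3 hε2.le) rfl
  have hsmall : ∀ ε₀ : ℝ, 0 < ε₀ → ∃ ε : ℝ, 0 < ε ∧ ε < ε₀ ∧ ε ≤ 1 ∧ zz ε = q := by
    intro ε₀ hε₀
    have h2 : ∀ᶠ ε in 𝓝[>] (0 : ℝ), ε < ε₀ := (eventually_lt_nhds hε₀).filter_mono nhdsWithin_le_nhds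
    have h2' : ∀ᶠ ε in 𝓝[>] (0 : ℝ), ε < 1 := (eventually_lt_nhds one_pos).filter_mono nhdsWithin_le_nhds
    have h3 : ∀ᶠ ε in 𝓝[>] (0 : ℝ), 0 < ε := eventually_mem_nhdsWithin
    obtain ⟨ε, hz, hlt, hlt1, hpos⟩ := (hfreq.and_eventually (h2.and (h2'.and h3))).exists
    exact ⟨ε, hpos, hlt, hlt1.le, hz⟩
  have hqZ : q ∈ Z := hqS.1
  refine ⟨q, hqZ, ?_, fun s hs hst hRT => ?_⟩
  · -- distance to `p`
    refine le_of_forall_pos_lt_add fun τ hτ => ?_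
    obtain ⟨ε, hε, hετ, hε1, hzq⟩ := hsmall (τ / 2) (by linarith)
    obtain ⟨-, hqd⟩ := hzz ε hε hε1
    rw [hzq] at hqd
    have h1 := dist_triangle q (yk ε) p
    have h2 := dist_triangle (yk ε) (pn ε) p
    have h3 := dist_comm q (yk ε)
    linarith [(hyk ε hε).2.1, (hpn ε hε).2]
  · -- a pass of the relaxed test at `q` would cross to the approximant's violator
    obtain ⟨ε, hε, hεs, hε1, hzq⟩ := hsmall (min ((t - s) / 3) (min (δ / 4) (1 / 2))) (by positivity)
    have hε3 : 3 * ε < t - s := by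
      have := min_le_left ((t - s) / 3) (min (δ / 4) (1 / 2)); linarith
    have hεδ : 2 * ε < δ := by
      have := (min_le_right ((t - s) / 3) (min (δ / 4) (1 / 2))).trans (min_le_left _ _); linarith
    have hε2 : ε ≤ 1 / 2 := by
      have := (min_le_right ((t - s) / 3) (min (δ / 4) (1 / 2))).trans (min_le_right _ _); linarith
    obtain ⟨hy, -, hn⟩ := hyk ε hε
    obtain ⟨-, hqd⟩ := hzz ε hε hε1
    rw [hzq] at hqd
    have hqn : ‖q‖ ≤ ‖p‖ + |L| + 2 := by
      have := norm_le_of_dist_le (mem_closedBall.1 hqS.2)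
      linarith
    have hR1 : ‖q‖ + s + 4 ≤ R₀ := by
      have : s ≤ |t| := by linarith [le_abs_self t]
      linarith [abs_nonneg L]
    exact hn (s + 3 * ε) (by linarith) (by linarith)
      (rt_of_match hsep (hsepk _) hε.le hεδ hε2 (hk ε hε).1.symm ha0 ha1 hs.le hqZ hy (by rw [dist_comm]; exact hqd) hR1 hRT)

/-! ## §G  ε-regularity from the Liouville statement; the cones -/

/-- **The blow-down.**  `MuGSCLimitClosed → CleanLiouville T₀ D → CleanRegularity T₀ D` (`0 ≤ T₀`): a failure of ε-regularity along
radii `R = n → ∞`, re-rooted at the centres of the `T₀`-clean balls, has a two-way locally matched subsequence whose limit is a globally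
`T₀`-clean `9/10`-covering `μ`-ground state with loosened thin cores and `t`-robust violators `L`-densely — which the Liouville statement
declares clean at margin `t/2`. [this file] -/
theorem cleanRegularity_of_cleanLiouville {T₀ D : ℝ} (hT₀ : 0 ≤ T₀) (hclo : MuGSCLimitClosed) (hL : CleanLiouville T₀ D) :
    CleanRegularity T₀ D := by
  classical
  intro e hT hlb δ hδ a ha1 ha2 t ht ht1 L
  by_contra hno
  push Not at hno
  choose Y hsepY hcovY hμY hthinY q hq hcleanY hviolY using fun n : ℕ => hno (n : ℝ)
  -- re-root at the centres
  set Zs : ℕ → Set (EuclideanSpace ℝ (Fin 3)) := fun n => (fun p => p - q n) '' Y n with hZs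
  have hsepk : ∀ n, ∀ p ∈ Zs n, ∀ p' ∈ Zs n, p ≠ p' → δ ≤ dist p p' := fun n => sep_translate (q n) (hsepY n)
  have hsolidk : ∀ n, ∀ z : EuclideanSpace ℝ (Fin 3), ∃ w ∈ Zs n, dist z w ≤ 9 / 10 := fun n =>
    solid_translate (q n) fun z =>
      let ⟨w, hw, hd⟩ := hcovY n z
      ⟨w, hw, hd.le⟩
  have hμk : ∀ n, IsMuGSC lennardJones e (Zs n) := fun n => isMuGSC_translate ⟨δ, hδ, hsepY n⟩ (hμY n) (q n)
  have hthink : ∀ n, ThinCoresL a D (Zs n) := fun n => thinCoresL_translate (q n) (thinCoresL_of_thinCores ha1 (hthinY n))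
  have hcleank : ∀ n, ∀ y ∈ Zs n, ‖y‖ ≤ (n : ℝ) → RT a T₀ (Zs n) y := by
    rintro n _ ⟨p, hp, rfl⟩ hn
    have hd : dist p (q n) ≤ n := by rwa [dist_eq_norm]
    exact rt_translate (q n) (hcleanY n p hp hd)
  have hviolk : ∀ n, ∀ q' ∈ Zs n, ‖q'‖ ≤ (n : ℝ) → ∃ y ∈ Zs n, dist y q' ≤ L ∧ ∀ s : ℝ, 0 < s → s < t → ¬ RT a s (Zs n) y := by
    rintro n _ ⟨p', hp', rfl⟩ hn
    have hd : dist p' (q n) ≤ n := by rwa [dist_eq_norm]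
    obtain ⟨y, hy, hyd, hyn⟩ := hviolY n p' hp' hd
    refine ⟨y - q n, ⟨y, hy, rfl⟩, by rwa [dist_sub_right], fun s hs hst hRT => hyn ?_⟩
    have h1 := rt_translate (-q n) hRT
    rw [translate_translate, sub_neg_eq_add, sub_add_cancel] at h1
    exact rt_mono ⟨δ, hδ, hsepY n⟩ hst.le h1
  -- a two-way locally matched subsequence and its limit
  obtain ⟨φ, Z, hφ, hZsep, hconv⟩ := exists_subseq_forall_eventually_match hδ Zs hsepk
  have hρ : Tendsto (fun k : ℕ => ((φ k : ℕ) : ℝ)) atTop atTop := tendsto_natCast_atTop_atTop.comp hφ.tendsto_atTop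
  have hZsolid : ∀ z : EuclideanSpace ℝ (Fin 3), ∃ w ∈ Z, dist z w ≤ 9 / 10 :=
    solid_of_limit hδ hZsep hconv fun k => hsolidk (φ k)
  have hZμ : IsMuGSC lennardJones e Z := hclo e δ hδ (fun k => Zs (φ k)) Z (fun k => hsepk (φ k)) (fun k => hμk (φ k)) hZsep hconv
  have hZthin : ThinCoresL a D Z := thinCoresL_of_limit hδ ha1 ha2 (fun k => hsepk (φ k)) hZsep hconv fun k => hthink (φ k)
  have hZclean : ∀ y' ∈ Z, ∀ s : ℝ, T₀ < s → RT a s Z y' :=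
    rtAbove_of_limit hδ ha1 ha2 hT₀ (fun k => hsepk (φ k)) hZsep hconv hρ fun k => hcleank (φ k)
  have hZviol : ViolatorsL a t L Z :=
    violatorsL_of_limit_local hδ ha1 ha2 (fun k => hsepk (φ k)) hZsep hconv hρ fun k => hviolk (φ k)
  -- the Liouville statement forbids the limit's violator
  obtain ⟨w, hw, -⟩ := hZsolid 0
  obtain ⟨y, hy, -, hn⟩ := hZviol w hw
  exact hn (t / 2) (by linarith) (by linarith)
    (hL e hT hlb Z ⟨δ, hδ, hZsep⟩ hZsolid hZμ a ha1 ha2 hZthin hZclean (t / 2) (by linarith) y hy)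

/-- **The cut, blown down.**  `GrossCleanBalls T₀ D → CleanLiouville T₀ D → MuGSCLimitClosed → MuCleanBalls D` for `T₀ ∈ (0, 1/10]`.
[this file] -/
theorem muCleanBalls_of_gross_liouville {T₀ D : ℝ} (hT : 0 < T₀) (hG : GrossCleanBalls T₀ D) (hL : CleanLiouville T₀ D)
    (hclo : MuGSCLimitClosed) : MuCleanBalls D :=
  muCleanBalls_of_gross_soft hG (softCleanBalls_of_cleanRegularity (cleanRegularity_of_cleanLiouville hT.le hclo hL))

/-- **The cone of the node.**  `GrossCleanBalls T₀ 10 → CleanLiouville T₀ 10 → MuGSCLimitClosed → CleanlessExcessT → CoherentResidual 10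
→ RobustDefectLimitWindows` for `T₀ > 0` (recommended `T₀ = 1/250`). [this file] -/
theorem rdef_of_gross_liouville_coherent {T₀ : ℝ} (hT : 0 < T₀) (hG : GrossCleanBalls T₀ 10) (hL : CleanLiouville T₀ 10)
    (hclo : MuGSCLimitClosed) (hCE : CleanlessExcessT) (hR : CoherentResidual 10) : RobustDefectLimitWindows :=
  rdef_of_muCleanBalls_coherent (muCleanBalls_of_gross_liouville hT hG hL hclo) hCE hR

end Summit.AtomisticToContinuum.Crystallization.Theorems.OverbindingBudgetRegularityCutLimit
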